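import Literature.MathematicalPhysics.QuantumFieldTheory.Balaban1983to89.B12SecondOrder267Concrete

/-!
# `Balaban1983to89.B11Eq56SeriesConcrete` — T. Bałaban, *The variational problem and background fields in renormalization group method for
lattice gauge theories*, Commun. Math. Phys. **102** (1985) 277–309 [Balaban1985Variational], (55)–(56) p. 286: **«THIS IMPLIES THAT A POWER
SERIES EXPANSION OF D(A′) BEGINS WITH SECOND ORDER TERMS» AND (56) «C_j(LʲηA′ − LʲηHD(A′)) = … = Σ_{n=2}^∞ D^{(n)}(A′)» (LEFT MEMBER
`= D(A′)` BY (49)) AS A CONVERGENT SERIES, FOR THE CONCRETE FIXED POINT `D̃` OF (49) BUILT ON THE REMAINDER `C_j(U₀, ·)` OF [4] ON THE `ℤᵈ` CARRIER** — the homogeneous terms `D̃⁽ⁿ⁾(A′) := (n!)⁻¹(dⁿ/dtⁿ)D̃(tA′)|₀`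
exist for every `A′` of the ball (51) `‖A′‖ < ε₃`, those of orders `0`, `1` vanish ((55)), EVERY term obeys the Cauchy bound
`‖D̃⁽ⁿ⁾(A′)‖ ≤ 4C₂(Lʲ)²ε₃²·(‖A′‖/ε₃)ⁿ`, they are homogeneous of order `n`, their sum IS `D̃(A′)` on the whole ball, and the term of order two is
`C⁽²⁾(A′)` («For example we have on Λ_j D^{(2)}(A′) = C_j^{(2)}(LʲηA′)», after (56)) — the `D`-side companion of `B7Eq136Series` ((136)
for `C_j`)

statement-level skeleton of published theorems with citation tags; proofs where landed; nothing here is a claim about the Yang–Mills mass gap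

v1.1 (p06 gen 17, 2026-08-22): DOCFIX ONLY — the «THE PRINT (p. 286)» quotation and the three short quotations of the sentence after (56) re-typed
VERBATIM from the page (render `…-p010-x2.png`, text layer `p0010.txt` L19–29): v1 carried «… begins with second order terms and these terms can
be calculated easily using the above equation: …» and «Especially we have D^{(2)}(A′) = C^{(2)}(LʲηA′)» inside the guillemets, where the print
has «… begins with second order terms. We can find this expression from Eq. (49) and the expansion (136) [4] of the function C_j: …» and «For
example we have on Λ_j D^{(2)}(A′) = C_j^{(2)}(LʲηA′), …» — r08 `QUOTE-AUDIT-B11.md` §E item R2; declarations byte-identical.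

PDF held: `paper:balaban1985-cmp102-variational-background` (journal page = PDF page + 276); p. 286 [PDF 10], text layer `p0010.txt` (the
displays (55)–(56) quoted from r08's transcription in `B11Eq56Expansion`'s header, re-read by this seat); [4] = `paper:balaban1985-cmp98-averaging`
(136) p. 39.

CITATION HEADER / WHAT IS REPRODUCED.  Cell `lit-balaban`, Phase-2 proof seat p06 gen 6 = unit `lit-balaban-p06` (TAKING addendum HOME/STATUS.md
2026-08-21T17:37:00Z); SKELETON row **B11.Eq55** ((55)–(56); owner r08: (55) = `B13Contraction113.bound_114` / `B11Eq44Concrete.bound_114_concrete`,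
«begins with second order terms» = r08's one-variable `B11SchwarzRemainder.reading_begins_at_two` and r09/p06's `B12SecondOrder267Concrete.
p267_second_order_concrete` (ii) (a power series AT `0` with `p₀ = p₁ = 0`, unspecified radius), (56) at orders two/three = `B11Eq56Expansion` /
`B11Eq44Concrete.eq56_order2_concrete` (remainder form)).  THIS FILE: the display (56) ITSELF — `D̃` as the SUM of its homogeneous terms on the
whole ball (51), every term named and bounded.  THE PRINT (p. 286, verbatim): *«|D(A′)| = |C_j(LʲηA′ − LʲηHD(A′))| ≦ C₂(Lʲη|A′| + B₀|D(A′)|)² ≦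
4C₂|A′|²₍₋₁₎. (55) This implies that a power series expansion of D(A′) begins with second order terms. We can find this expression from
Eq. (49) and the expansion (136) [4] of the function C_j: C_j(LʲηA′ − LʲηHD(A′)) = Σ_{n=2}^∞ C_j^{(n)}(LʲηA′ − LʲηH Σ_{m=2}^∞ D^{(m)}(A′))
= Σ_{n=2}^∞ D^{(n)}(A′), (56) where C_j^{(n)}, D^{(n)} are homogeneous polynomials of nth order. From Eq. (56) a sequence of recursive equations
for D^{(n)} follows. It can be solved easily. For example we have on Λ_j D^{(2)}(A′) = C_j^{(2)}(LʲηA′), D^{(3)}(A′) = C_j^{(3)}(LʲηA′)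
− 2C_j^{(2)}(LʲηA′, LʲηHC^{(2)}(A′)), and so on. Here C_j^{(2)}(A′, A″) denotes a symmetric bilinear form obtained by polarization from the
quadratic form C_j^{(2)}(A), and C^{(2)}(A′) = C_j^{(2)}(LʲηA′) on Λ_j.»*; after (54): *«This solution is a limit of uniformly convergent
sequence of successive approximations and it is an analytic function of A′.»*  The radius (the whole ball (51)) and the geometric bounds below are printed nowhere (the print
asserts the expansion); they are what Cauchy's estimate gives from the analyticity of `D̃` on the ball (`B12SecondOrder267Concrete.
analyticOnNhd_Dt_concrete`) and (55) — our formalisation of (56) as a theorem about the concrete `D̃`.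

DICTIONARY (as `B11Eq44Concrete` / `B12SecondOrder267Concrete`: tree units, scales absorbed, sup norms).  `𝒴 = 𝔸^S ∋ A′`, `𝒳 = 𝔸^T`;
`Cmap a = (C_j(U₀, ins_S a)(c))_{c∈T}`; `H ↦ hop : 𝔸^T →ₗ[ℂ] 𝔸^S` with `‖hop X‖ ≤ B₀‖X‖` ((46)); `D ↦ D̃ = Dt`, ANY map with the fixed-point
characterization (49) + (55)-ball on `‖A′‖ < ε` (hypotheses `hDfix`, `hDball`; such a map exists and is unique there:
`B12SecondOrder267Concrete.exists_Dt_concrete`, `B11Eq44Concrete.exists_unique_fixedPoint_concrete`); **`D^{(n)}(A′)` ↦ `DtN Dt A′ n :=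
(n!)⁻¹·(dⁿ/dtⁿ)D̃(t·A′)|_{t=0}`** (the `tⁿ`-coefficient of the complex slice `t ↦ D̃(tA′)`, an `𝔸^T`-valued homogeneous polynomial of order `n` in
`A′`); `C_j^{(2)}(LʲηA′)` (`= C^{(2)}(A′)` on `Λ_j`) ↦ `C2map L U₀ S T j A′ A′`; print's `C₂` ↦ `C₂(Lʲ)²` with `C₂ = 8·C₁·e^{4cα₀}` (local notation), `ε₃` ↦ `ε`.  Regime =
`B11Eq44Concrete`'s (regular background, witness radius `b`, [4] smallness incl. (145)/(155), `j ≤ k`) with the contraction hypotheses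
«9C₂B₀ε₃ < 1» ((54)) and `3ε ≤ b`.

WHAT THIS FILE PROVES (one definition with body + theorems; kernel, 0 sorry, standard axioms), for `j ≤ k` and `D̃` as above:
* §1 `DtN` (definition above), `DtN_def`.
* §2 the slice `t ↦ D̃(tA′)`: `analyticAt_Dt_slice` (analytic wherever `|t|·‖A′‖ < ε`), `norm_Dt_slice_le` ((55) along the slice:
  `‖D̃(tA′)‖ ≤ 4C₂(Lʲ)²(|t|‖A′‖)²`), `diffContOnCl_Dt_slice`; **(55) ⇒ NO TERMS OF ORDER 0 AND 1**: `Dt_slice_zero_and_deriv_zero`, **`DtN_zero`**,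
  **`DtN_one`** (r08's `reading_begins_at_two` on (55) along the slice).
* §3 **CAUCHY BOUNDS FOR EVERY ORDER**: `norm_iteratedDeriv_Dt_slice_le`, `norm_DtN_le_of_radius` (on any circle `|t| = r`, `r‖A′‖ < ε`),
  **`norm_DtN_le`** (`‖D̃⁽ⁿ⁾(A′)‖ ≤ 4C₂(Lʲ)²ε²·(‖A′‖/ε)ⁿ` for `‖A′‖ < ε`: the limit `r → ε/‖A′‖`); **`DtN_smul`** (`D̃⁽ⁿ⁾(s·A′) = sⁿ·D̃⁽ⁿ⁾(A′)` for
  every `s ∈ ℂ`: «homogeneous polynomials of n-th order»).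
* §4 **(56) AS A CONVERGENT SERIES**: `hasFPowerSeriesOnBall_Dt_slice`, `hasSum_DtN_slice` (`Σ_n tⁿD̃⁽ⁿ⁾(A′) = D̃(tA′)` for `|t|‖A′‖ < ε`),
  **`hasSum_DtN`** (for `‖A′‖ < ε`: `Σ_n D̃⁽ⁿ⁾(A′) = D̃(A′)` — (56) VERBATIM, the sum starting in effect at `n = 2` by §2), `Dt_eq_tsum`,
  **`norm_Dt_sub_partialSum_le`** (`‖D̃(A′) − Σ_{n<N} D̃⁽ⁿ⁾(A′)‖ ≤ 4C₂(Lʲ)²ε²(‖A′‖/ε)ᴺ(1 − ‖A′‖/ε)⁻¹`, every `N`).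
* §5 **«FOR EXAMPLE WE HAVE ON Λ_j D^{(2)}(A′) = C_j^{(2)}(LʲηA′)» AS AN IDENTITY OF TAYLOR TERMS**: **`DtN_two`** (`D̃⁽²⁾(A′) = C2map A′ A′` for every `A′` of
  the ball — from the order-two remainder `B11Eq44Concrete.eq56_order2_concrete` and the tail bound of §4 along the ray `tA′`, `t → 0`).
NOT CLAIMED: the identification of `D̃⁽³⁾` with the printed `D^{(3)}` (it follows the same way from the order-three remainder of
`B11Eq56Order3Concrete`, filed separately), the polarizations of `D̃⁽ⁿ⁾`, optimality of constants, anything about `Λ_j`/scales.  NOT summit progress.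
-/

noncomputable section

open scoped BigOperators Topology NNReal
open NormedSpace Finset Metric Filter

namespace Literature.MathematicalPhysics.QuantumFieldTheory.Balaban1983to89.B11Eq56SeriesConcrete

open B7Prop1Explicit B7Prop1Local B7Prop2Explicit B7Prop3Flat B7Prop4Flat B7Eq92Concrete B7Prop3GeneralLinear
  B7Prop4GeneralLevels B7Prop5GeneralLevels B7Eq136SecondOrder B13Contraction113 B11Eq44Concrete B12SecondOrder267Concrete
open B11SchwarzRemainder (reading_begins_at_two)

-- `Site` alone would resolve to the torus sites of `Setup.lean`; re-export the `ℤ^d` sites of `B7Prop1Explicit`.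
export B7Prop1Explicit (Site)

variable {d : ℕ}

/-! ## §1 The homogeneous terms `D̃⁽ⁿ⁾(A′)` -/

section Def

variable {𝔸 : Type*} [NormedRing 𝔸] [NormedAlgebra ℂ 𝔸] {S T : Finset (Site d × Fin d)}

/-- **`D̃⁽ⁿ⁾(A′)`, THE TERM OF ORDER `n` OF THE FIXED POINT `D̃`** — [B11] (56) «Σ_{n=2}^∞ D^{(n)}(A′), where … D^{(n)} are homogeneous polynomials
of n-th order»: the `tⁿ`-coefficient `(n!)⁻¹·(dⁿ/dtⁿ)D̃(t·A′)|_{t=0}` of the complex slice `t ↦ D̃(tA′)` (an element of `𝔸^T`), for a map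
`D̃ : 𝔸^S → 𝔸^T`. [cite: Balaban1985Variational, (56) p.286] -/
def DtN (Dt : (S → 𝔸) → (T → 𝔸)) (A' : S → 𝔸) (n : ℕ) : T → 𝔸 :=
  ((Nat.factorial n : ℕ) : ℂ)⁻¹ • iteratedDeriv n (fun t : ℂ => Dt (t • A')) 0

/-- `DtN` unfolded. [cite: Balaban1985Variational, (56) p.286] -/
theorem DtN_def (Dt : (S → 𝔸) → (T → 𝔸)) (A' : S → 𝔸) (n : ℕ) :
    DtN Dt A' n = ((Nat.factorial n : ℕ) : ℂ)⁻¹ • iteratedDeriv n (fun t : ℂ => Dt (t • A')) 0 := rfl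

end Def

/-! ## §1b Scaling of slice derivatives; radii (generic, private) -/

section Scaling

variable {F : Type*} [NormedAddCommGroup F] [NormedSpace ℂ F] [CompleteSpace F]

/-- for `ψ` analytic near `0` and any `s ∈ ℂ`: near `t = 0`, `(dⁿ/dtⁿ)[ψ(s·t)] = sⁿ·ψ⁽ⁿ⁾(s·t)` (chain rule `n` times; derivatives of
eventually equal functions agree). [folklore] -/
private theorem iteratedDeriv_comp_mul_eventually {ψ : ℂ → F} (hψ : ∀ᶠ u in 𝓝 (0 : ℂ), AnalyticAt ℂ ψ u) (s : ℂ) (n : ℕ) :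
    ∀ᶠ t in 𝓝 (0 : ℂ), iteratedDeriv n (fun u : ℂ => ψ (s * u)) t = s ^ n • iteratedDeriv n ψ (s * t) := by
  have hline : Tendsto (fun t : ℂ => s * t) (𝓝 0) (𝓝 0) := by
    have hc : Continuous (fun t : ℂ => s * t) := continuous_const_mul s
    simpa using hc.tendsto 0
  have hev : ∀ᶠ t : ℂ in 𝓝 0, AnalyticAt ℂ ψ (s * t) := hline.eventually hψ
  induction n with
  | zero => exact Eventually.of_forall fun t => by simp
  | succ n ih =>
    filter_upwards [ih.eventually_nhds, hev] with t ht han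
    rw [iteratedDeriv_succ, Filter.EventuallyEq.deriv_eq ht]
    have hψn : AnalyticAt ℂ (iteratedDeriv n ψ) (s * t) := by
      rw [iteratedDeriv_eq_iterate]; exact han.iterated_deriv n
    have h1 : HasDerivAt (fun u : ℂ => s * u) s t := by simpa using (hasDerivAt_id t).const_mul s
    have h2 : HasDerivAt (iteratedDeriv n ψ) (iteratedDeriv (n + 1) ψ (s * t)) (s * t) := by
      rw [iteratedDeriv_succ]; exact hψn.differentiableAt.hasDerivAt
    have h3 := (h2.scomp t h1).const_smul (s ^ n)
    rw [show deriv (fun u : ℂ => s ^ n • iteratedDeriv n ψ (s * u)) t = s ^ n • s • iteratedDeriv (n + 1) ψ (s * t)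
      from h3.deriv, smul_smul, pow_succ]

/-- a radius strictly between: if `c·m < ε` with `c, m ≥ 0`, `ε > 0`, then `c < r` and `r·m < ε` for some `r`. [folklore] -/
private theorem exists_radius {c m ε : ℝ} (hm : 0 ≤ m) (hε : 0 < ε) (h : c * m < ε) :
    ∃ r : ℝ, c < r ∧ r * m < ε := by
  rcases hm.eq_or_lt with hm0 | hm0
  · exact ⟨c + 1, by linarith, by rw [← hm0, mul_zero]; exact hε⟩
  · obtain ⟨r, hcr, hr⟩ := exists_between ((lt_div_iff₀ hm0).2 h)
    exact ⟨r, hcr, (lt_div_iff₀ hm0).1 hr⟩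

end Scaling

/-! ## §2–§5 Along the slice `t ↦ D̃(tA′)`: vanishing of orders 0, 1; Cauchy bounds; the convergent series (56); the order-two term -/

section Regime

variable {𝔸 : Type*} [NormedRing 𝔸] [NormedAlgebra ℂ 𝔸] [CompleteSpace 𝔸] [NormOneClass 𝔸]

variable (L : ℕ) (hL : 2 ≤ L) {G : Subgroup 𝔸ˣ} (hG : AvgClosed d L G) (k : ℕ)
  (U₀ : Site d → Fin d → 𝔸ˣ) (hU₀ : ∀ x κ, U₀ x κ ∈ G) {α₀ : ℝ} (hα : 0 < α₀)
  (hα3 : C0 d * α₀ ≤ 1 / 3) (hα4 : 4 * α₀ ≤ c2' d L) (h52 : pdev U₀ < α₀ * (((L : ℝ) ^ k)⁻¹) ^ 2)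
  {b : ℝ} (hb : 0 < b)
  (hsmall : Real.exp (4 * (800 * ((d : ℝ) + 1) ^ 2 * ((d : ℝ) + 4)) * α₀)
    * (1 + 8 * (131072 * ((d : ℝ) + 1) ^ 2) * ((L : ℝ) ^ k * b)) ≤ 2)
  (hc₃ : 4 * ((L : ℝ) ^ k * b) < c3 d L)
  (h145 : 8 * d * thetaGen d L α₀ * (L : ℝ)⁻¹ ^ 4 ≤ 1)
  (h155 : (2 * (L : ℝ) - 1) * (L : ℝ)⁻¹ ^ 2 + 2 * d * thetaGen d L α₀ * (L : ℝ)⁻¹ ^ 3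
    + 1 / 8 * (1 + 2 * d * thetaGen d L α₀ * (L : ℝ)⁻¹ ^ 2 + 2 * d * C3Gen d L * ((L : ℝ) ^ k * b)) * (L : ℝ)⁻¹ ^ 2 ≤ 1)
  (S T : Finset (Site d × Fin d)) (hop : (T → 𝔸) →ₗ[ℂ] (S → 𝔸)) {B₀ ε : ℝ} {Dt : (S → 𝔸) → (T → 𝔸)}

/-- print's `C₂` of (44)/(55) = [4] (135) at a general background: `8·C₁·e^{4cα₀}`. -/
local notation "C₂" => (8 * (131072 * ((d : ℝ) + 1) ^ 2) * Real.exp (4 * (800 * ((d : ℝ) + 1) ^ 2 * ((d : ℝ) + 4)) * α₀))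

include hL hG hU₀ hα hα3 hα4 h52 hb hsmall hc₃ in
/-- **THE SLICE IS ANALYTIC WHEREVER `|t|·‖A′‖ < ε`**: `D̃` is analytic on the ball (51) (`B12SecondOrder267Concrete.analyticOnNhd_Dt_concrete`, «an
analytic function of A′») and `t ↦ tA′` is linear. [cite: Balaban1985Variational, (54) p.286, (56) p.286] -/
theorem analyticAt_Dt_slice {j : ℕ} (hj : j ≤ k) (hB₀ : 0 ≤ B₀) (hHop : ∀ X, ‖hop X‖ ≤ B₀ * ‖X‖)
    (hq : 9 * (C₂ * ((L : ℝ) ^ j) ^ 2) * B₀ * ε < 1) (hε : 3 * ε ≤ b)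
    (hDball : ∀ B : S → 𝔸, ‖B‖ < ε → Dt B ∈ closedBall (0 : T → 𝔸) (4 * (C₂ * ((L : ℝ) ^ j) ^ 2) * ε ^ 2))
    (hDfix : ∀ B : S → 𝔸, ‖B‖ < ε → Cmap L U₀ S T j (B - hop (Dt B)) = Dt B) (A' : S → 𝔸) {t : ℂ} (ht : ‖t‖ * ‖A'‖ < ε) :
    AnalyticAt ℂ (fun u : ℂ => Dt (u • A')) t := by
  have han := analyticOnNhd_Dt_concrete L hL hG k U₀ hU₀ hα hα3 hα4 h52 hb hsmall hc₃ S T hop hj hB₀ hHop hq hε hDball hDfix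
  have hmem : t • A' ∈ ball (0 : S → 𝔸) ε := by
    rw [mem_ball_zero_iff, norm_smul]; exact ht
  have hlin : AnalyticAt ℂ (fun u : ℂ => u • A') t := analyticAt_id.smul analyticAt_const
  exact (han _ hmem).comp_of_eq hlin rfl

include hL hG hU₀ hα hα3 hα4 h52 hb hsmall hc₃ in
/-- **(55) ALONG THE SLICE**: `‖D̃(tA′)‖ ≤ 4C₂(Lʲ)²·(|t|‖A′‖)²` whenever `|t|·‖A′‖ < ε` (`B11Eq44Concrete.bound_114_concrete` at `tA′`).
[cite: Balaban1985Variational, (55) p.286] -/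
theorem norm_Dt_slice_le {j : ℕ} (hj : j ≤ k) (hB₀ : 0 ≤ B₀) (hHop : ∀ X, ‖hop X‖ ≤ B₀ * ‖X‖)
    (hq : 9 * (C₂ * ((L : ℝ) ^ j) ^ 2) * B₀ * ε < 1) (hε : 3 * ε ≤ b)
    (hDball : ∀ B : S → 𝔸, ‖B‖ < ε → Dt B ∈ closedBall (0 : T → 𝔸) (4 * (C₂ * ((L : ℝ) ^ j) ^ 2) * ε ^ 2))
    (hDfix : ∀ B : S → 𝔸, ‖B‖ < ε → Cmap L U₀ S T j (B - hop (Dt B)) = Dt B) (A' : S → 𝔸) {t : ℂ} (ht : ‖t‖ * ‖A'‖ < ε) :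
    ‖Dt (t • A')‖ ≤ 4 * (C₂ * ((L : ℝ) ^ j) ^ 2) * (‖t‖ * ‖A'‖) ^ 2 := by
  have hA : ‖t • A'‖ < ε := by rw [norm_smul]; exact ht
  have h := bound_114_concrete L hL hG k U₀ hU₀ hα hα3 hα4 h52 hb hsmall hc₃ S T hop hj hB₀ hHop hA hq hε (hDball _ hA) (hDfix _ hA)
  rwa [norm_smul] at h

include hL hG hU₀ hα hα3 hα4 h52 hb hsmall hc₃ in
/-- the slice is differentiable on the disc `|t| < r` and continuous on its closure whenever `r·‖A′‖ < ε`. [cite: Balaban1985Variational, (54) p.286] -/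
theorem diffContOnCl_Dt_slice {j : ℕ} (hj : j ≤ k) (hB₀ : 0 ≤ B₀) (hHop : ∀ X, ‖hop X‖ ≤ B₀ * ‖X‖)
    (hq : 9 * (C₂ * ((L : ℝ) ^ j) ^ 2) * B₀ * ε < 1) (hε : 3 * ε ≤ b)
    (hDball : ∀ B : S → 𝔸, ‖B‖ < ε → Dt B ∈ closedBall (0 : T → 𝔸) (4 * (C₂ * ((L : ℝ) ^ j) ^ 2) * ε ^ 2))
    (hDfix : ∀ B : S → 𝔸, ‖B‖ < ε → Cmap L U₀ S T j (B - hop (Dt B)) = Dt B) (A' : S → 𝔸) {r : ℝ} (hr : r * ‖A'‖ < ε) :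
    DiffContOnCl ℂ (fun u : ℂ => Dt (u • A')) (ball (0 : ℂ) r) := by
  have hcl : ∀ t ∈ closedBall (0 : ℂ) r, AnalyticAt ℂ (fun u : ℂ => Dt (u • A')) t := by
    intro t ht
    rw [mem_closedBall_zero_iff] at ht
    refine analyticAt_Dt_slice L hL hG k U₀ hU₀ hα hα3 hα4 h52 hb hsmall hc₃ S T hop hj hB₀ hHop hq hε hDball hDfix A' ?_
    exact lt_of_le_of_lt (mul_le_mul_of_nonneg_right ht (norm_nonneg _)) hr
  exact (DifferentiableOn.mono (fun t ht => (hcl t ht).differentiableAt.differentiableWithinAt)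
    closure_ball_subset_closedBall).diffContOnCl

include hL hG hU₀ hα hα3 hα4 h52 hb hsmall hc₃ in
/-- **(55) ⇒ THE SLICE VANISHES TO SECOND ORDER AT `0`**: `D̃(0·A′) = 0` and `(d/dt)D̃(tA′)|₀ = 0` (r08's `B11SchwarzRemainder.reading_begins_at_two`
on the bound `‖D̃(tA′)‖ ≤ 4C₂(Lʲ)²‖A′‖²|t|²` of `norm_Dt_slice_le`, on the disc `|t| < ε/(‖A′‖ + 1)`). [cite: Balaban1985Variational, (55)–(56) p.286] -/
theorem Dt_slice_zero_and_deriv_zero {j : ℕ} (hj : j ≤ k) (hB₀ : 0 ≤ B₀) (hHop : ∀ X, ‖hop X‖ ≤ B₀ * ‖X‖)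
    (hq : 9 * (C₂ * ((L : ℝ) ^ j) ^ 2) * B₀ * ε < 1) (hε : 3 * ε ≤ b) (hε0 : 0 < ε)
    (hDball : ∀ B : S → 𝔸, ‖B‖ < ε → Dt B ∈ closedBall (0 : T → 𝔸) (4 * (C₂ * ((L : ℝ) ^ j) ^ 2) * ε ^ 2))
    (hDfix : ∀ B : S → 𝔸, ‖B‖ < ε → Cmap L U₀ S T j (B - hop (Dt B)) = Dt B) (A' : S → 𝔸) :
    Dt ((0 : ℂ) • A') = 0 ∧ deriv (fun u : ℂ => Dt (u • A')) 0 = 0 := by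
  -- a disc on which `|t|·‖A′‖ < ε`
  set r : ℝ := ε / (‖A'‖ + 1) with hr
  have hA1 : 0 < ‖A'‖ + 1 := by positivity
  have hr0 : 0 < r := div_pos hε0 hA1
  have hrA : r * ‖A'‖ < ε := by
    have h1 : r * ‖A'‖ ≤ r * (‖A'‖ + 1) := mul_le_mul_of_nonneg_left (by linarith) hr0.le
    have h2 : r * (‖A'‖ + 1) = ε := by rw [hr]; field_simp
    have h3 : r * ‖A'‖ < r * (‖A'‖ + 1) := by nlinarith
    linarith
  have hin : ∀ t ∈ ball (0 : ℂ) r, ‖t‖ * ‖A'‖ < ε := by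
    intro t ht
    rw [mem_ball_zero_iff] at ht
    exact lt_of_le_of_lt (mul_le_mul_of_nonneg_right ht.le (norm_nonneg _)) hrA
  have hK : 0 ≤ C₂ * ((L : ℝ) ^ j) ^ 2 * ‖A'‖ ^ 2 := by positivity
  have hd : DifferentiableOn ℂ (fun u : ℂ => Dt (u • A')) (ball (0 : ℂ) r) := fun t ht =>
    (analyticAt_Dt_slice L hL hG k U₀ hU₀ hα hα3 hα4 h52 hb hsmall hc₃ S T hop hj hB₀ hHop hq hε hDball hDfix A'
      (hin t ht)).differentiableAt.differentiableWithinAt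
  exact reading_begins_at_two hK hr0 hd fun t ht => by
    have h := norm_Dt_slice_le L hL hG k U₀ hU₀ hα hα3 hα4 h52 hb hsmall hc₃ S T hop hj hB₀ hHop hq hε hDball hDfix A' (hin t ht)
    refine h.trans (le_of_eq ?_)
    ring

include hL hG hU₀ hα hα3 hα4 h52 hb hsmall hc₃ in
/-- **NO TERM OF ORDER ZERO**: `D̃⁽⁰⁾(A′) = 0` (`D̃(0) = 0` by (55)). [cite: Balaban1985Variational, (55)–(56) p.286] -/
theorem DtN_zero {j : ℕ} (hj : j ≤ k) (hB₀ : 0 ≤ B₀) (hHop : ∀ X, ‖hop X‖ ≤ B₀ * ‖X‖)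
    (hq : 9 * (C₂ * ((L : ℝ) ^ j) ^ 2) * B₀ * ε < 1) (hε : 3 * ε ≤ b) (hε0 : 0 < ε)
    (hDball : ∀ B : S → 𝔸, ‖B‖ < ε → Dt B ∈ closedBall (0 : T → 𝔸) (4 * (C₂ * ((L : ℝ) ^ j) ^ 2) * ε ^ 2))
    (hDfix : ∀ B : S → 𝔸, ‖B‖ < ε → Cmap L U₀ S T j (B - hop (Dt B)) = Dt B) (A' : S → 𝔸) : DtN Dt A' 0 = 0 := by
  rw [DtN_def, iteratedDeriv_zero,
    (Dt_slice_zero_and_deriv_zero L hL hG k U₀ hU₀ hα hα3 hα4 h52 hb hsmall hc₃ S T hop hj hB₀ hHop hq hε hε0 hDball hDfix A').1,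
    smul_zero]

include hL hG hU₀ hα hα3 hα4 h52 hb hsmall hc₃ in
/-- **NO TERM OF ORDER ONE**: `D̃⁽¹⁾(A′) = 0` — «a power series expansion of D(A′) begins with second order terms».
[cite: Balaban1985Variational, (55)–(56) p.286] -/
theorem DtN_one {j : ℕ} (hj : j ≤ k) (hB₀ : 0 ≤ B₀) (hHop : ∀ X, ‖hop X‖ ≤ B₀ * ‖X‖)
    (hq : 9 * (C₂ * ((L : ℝ) ^ j) ^ 2) * B₀ * ε < 1) (hε : 3 * ε ≤ b) (hε0 : 0 < ε)
    (hDball : ∀ B : S → 𝔸, ‖B‖ < ε → Dt B ∈ closedBall (0 : T → 𝔸) (4 * (C₂ * ((L : ℝ) ^ j) ^ 2) * ε ^ 2))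
    (hDfix : ∀ B : S → 𝔸, ‖B‖ < ε → Cmap L U₀ S T j (B - hop (Dt B)) = Dt B) (A' : S → 𝔸) : DtN Dt A' 1 = 0 := by
  rw [DtN_def, iteratedDeriv_one,
    (Dt_slice_zero_and_deriv_zero L hL hG k U₀ hU₀ hα hα3 hα4 h52 hb hsmall hc₃ S T hop hj hB₀ hHop hq hε hε0 hDball hDfix A').2,
    smul_zero]

/-! ## §3 Cauchy bounds for every order; homogeneity -/

include hL hG hU₀ hα hα3 hα4 h52 hb hsmall hc₃ in
/-- **CAUCHY'S ESTIMATE FOR EVERY SLICE DERIVATIVE** on a circle `|t| = r` with `r·‖A′‖ < ε`: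
`‖(dⁿ/dtⁿ)D̃(tA′)|₀‖ ≤ n!·4C₂(Lʲ)²(r‖A′‖)²/rⁿ` (Mathlib `Complex.norm_iteratedDeriv_le_of_forall_mem_sphere_norm_le`; on the circle (55) gives
`‖D̃(tA′)‖ ≤ 4C₂(Lʲ)²(r‖A′‖)²`). [cite: Balaban1985Variational, (55)–(56) p.286] -/
theorem norm_iteratedDeriv_Dt_slice_le {j : ℕ} (hj : j ≤ k) (hB₀ : 0 ≤ B₀) (hHop : ∀ X, ‖hop X‖ ≤ B₀ * ‖X‖)
    (hq : 9 * (C₂ * ((L : ℝ) ^ j) ^ 2) * B₀ * ε < 1) (hε : 3 * ε ≤ b)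
    (hDball : ∀ B : S → 𝔸, ‖B‖ < ε → Dt B ∈ closedBall (0 : T → 𝔸) (4 * (C₂ * ((L : ℝ) ^ j) ^ 2) * ε ^ 2))
    (hDfix : ∀ B : S → 𝔸, ‖B‖ < ε → Cmap L U₀ S T j (B - hop (Dt B)) = Dt B) (A' : S → 𝔸) {r : ℝ} (hr0 : 0 < r)
    (hr : r * ‖A'‖ < ε) (n : ℕ) :
    ‖iteratedDeriv n (fun u : ℂ => Dt (u • A')) 0‖ ≤
      (Nat.factorial n : ℕ) * (4 * (C₂ * ((L : ℝ) ^ j) ^ 2) * (r * ‖A'‖) ^ 2) / r ^ n := by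
  have hsph : ∀ t ∈ sphere (0 : ℂ) r, ‖Dt (t • A')‖ ≤ 4 * (C₂ * ((L : ℝ) ^ j) ^ 2) * (r * ‖A'‖) ^ 2 := by
    intro t ht
    have htn : ‖t‖ = r := by simpa using ht
    have h := norm_Dt_slice_le L hL hG k U₀ hU₀ hα hα3 hα4 h52 hb hsmall hc₃ S T hop hj hB₀ hHop hq hε hDball hDfix A'
      (t := t) (by rw [htn]; exact hr)
    rwa [htn] at h
  exact Complex.norm_iteratedDeriv_le_of_forall_mem_sphere_norm_le n hr0
    (diffContOnCl_Dt_slice L hL hG k U₀ hU₀ hα hα3 hα4 h52 hb hsmall hc₃ S T hop hj hB₀ hHop hq hε hDball hDfix A' hr) hsph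

include hL hG hU₀ hα hα3 hα4 h52 hb hsmall hc₃ in
/-- Cauchy's estimate divided by `n!`: `‖D̃⁽ⁿ⁾(A′)‖ ≤ 4C₂(Lʲ)²(r‖A′‖)²/rⁿ` for every radius `0 < r` with `r·‖A′‖ < ε`.
[cite: Balaban1985Variational, (55)–(56) p.286] -/
theorem norm_DtN_le_of_radius {j : ℕ} (hj : j ≤ k) (hB₀ : 0 ≤ B₀) (hHop : ∀ X, ‖hop X‖ ≤ B₀ * ‖X‖)
    (hq : 9 * (C₂ * ((L : ℝ) ^ j) ^ 2) * B₀ * ε < 1) (hε : 3 * ε ≤ b)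
    (hDball : ∀ B : S → 𝔸, ‖B‖ < ε → Dt B ∈ closedBall (0 : T → 𝔸) (4 * (C₂ * ((L : ℝ) ^ j) ^ 2) * ε ^ 2))
    (hDfix : ∀ B : S → 𝔸, ‖B‖ < ε → Cmap L U₀ S T j (B - hop (Dt B)) = Dt B) (A' : S → 𝔸) {r : ℝ} (hr0 : 0 < r)
    (hr : r * ‖A'‖ < ε) (n : ℕ) :
    ‖DtN Dt A' n‖ ≤ 4 * (C₂ * ((L : ℝ) ^ j) ^ 2) * (r * ‖A'‖) ^ 2 / r ^ n := by
  have h := norm_iteratedDeriv_Dt_slice_le L hL hG k U₀ hU₀ hα hα3 hα4 h52 hb hsmall hc₃ S T hop hj hB₀ hHop hq hε hDball hDfix A'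
    hr0 hr n
  have hn : (0 : ℝ) < ((Nat.factorial n : ℕ) : ℝ) := by exact_mod_cast Nat.factorial_pos n
  rw [DtN_def, norm_smul, norm_inv, Complex.norm_natCast, inv_mul_le_iff₀ hn]
  refine h.trans (le_of_eq ?_)
  ring

include hL hG hU₀ hα hα3 hα4 h52 hb hsmall hc₃ in
/-- **THE HOMOGENEOUS TERMS DECAY GEOMETRICALLY INSIDE THE BALL (51)**: `‖D̃⁽ⁿ⁾(A′)‖ ≤ 4C₂(Lʲ)²·ε²·(‖A′‖/ε)ⁿ` for EVERY `A′ ∈ 𝔸^S` and every `n`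
(the radius `r ↑ ε/‖A′‖` in `norm_DtN_le_of_radius`; geometric decay for `‖A′‖ < ε`; at `n = 2` this is (55) for `D̃⁽²⁾`). [cite: Balaban1985Variational, (55)–(56) p.286] -/
theorem norm_DtN_le {j : ℕ} (hj : j ≤ k) (hB₀ : 0 ≤ B₀) (hHop : ∀ X, ‖hop X‖ ≤ B₀ * ‖X‖)
    (hq : 9 * (C₂ * ((L : ℝ) ^ j) ^ 2) * B₀ * ε < 1) (hε : 3 * ε ≤ b) (hε0 : 0 < ε)
    (hDball : ∀ B : S → 𝔸, ‖B‖ < ε → Dt B ∈ closedBall (0 : T → 𝔸) (4 * (C₂ * ((L : ℝ) ^ j) ^ 2) * ε ^ 2))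
    (hDfix : ∀ B : S → 𝔸, ‖B‖ < ε → Cmap L U₀ S T j (B - hop (Dt B)) = Dt B) (A' : S → 𝔸) (n : ℕ) :
    ‖DtN Dt A' n‖ ≤ 4 * (C₂ * ((L : ℝ) ^ j) ^ 2) * ε ^ 2 * (‖A'‖ / ε) ^ n := by
  set M : ℝ := 4 * (C₂ * ((L : ℝ) ^ j) ^ 2) with hM
  have hM0 : 0 ≤ M := by positivity
  by_cases hA0 : ‖A'‖ = 0
  · -- `A′ = 0`: the slice is the constant `D̃(0) = 0`, all terms vanish
    have hA0' : A' = 0 := norm_eq_zero.mp hA0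
    have hD0 : Dt 0 = 0 := by
      have h := norm_Dt_slice_le L hL hG k U₀ hU₀ hα hα3 hα4 h52 hb hsmall hc₃ S T hop hj hB₀ hHop hq hε hDball hDfix A'
        (t := 0) (by rw [norm_zero, zero_mul]; exact hε0)
      rw [zero_smul, norm_zero, zero_mul, zero_pow two_ne_zero, mul_zero] at h
      exact norm_le_zero_iff.mp h
    have hfun : (fun u : ℂ => Dt (u • A')) = fun _ => (0 : T → 𝔸) := by
      funext u; rw [hA0', smul_zero, hD0]
    have hzero : DtN Dt A' n = 0 := by
      rw [DtN_def, hfun, iteratedDeriv_const]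
      simp
    rw [hzero, norm_zero]; positivity
  -- `A′ ≠ 0`: let the radius increase to `R = ε/‖A′‖`
  have hApos : 0 < ‖A'‖ := lt_of_le_of_ne (norm_nonneg _) (Ne.symm hA0)
  set R : ℝ := ε / ‖A'‖ with hR
  have hR0 : 0 < R := div_pos hε0 hApos
  have hRA : R * ‖A'‖ = ε := by rw [hR]; field_simp
  -- the bound on every smaller circle
  have hev : ∀ᶠ r in 𝓝[<] R, ‖DtN Dt A' n‖ ≤ M * (r * ‖A'‖) ^ 2 / r ^ n := by
    filter_upwards [Ioo_mem_nhdsLT hR0] with r hr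
    have hrA : r * ‖A'‖ < ε := by
      calc r * ‖A'‖ < R * ‖A'‖ := mul_lt_mul_of_pos_right hr.2 hApos
        _ = ε := hRA
    exact norm_DtN_le_of_radius L hL hG k U₀ hU₀ hα hα3 hα4 h52 hb hsmall hc₃ S T hop hj hB₀ hHop hq hε hDball hDfix A' hr.1 hrA n
  -- its limit as `r ↑ R`
  have hcont : ContinuousAt (fun r : ℝ => M * (r * ‖A'‖) ^ 2 / r ^ n) R := by
    have hRn : R ^ n ≠ 0 := pow_ne_zero n hR0.ne'
    exact ((continuousAt_const.mul ((continuousAt_id.mul continuousAt_const).pow 2)).div (continuousAt_id.pow n) hRn)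
  have hlim : Tendsto (fun r : ℝ => M * (r * ‖A'‖) ^ 2 / r ^ n) (𝓝[<] R) (𝓝 (M * (R * ‖A'‖) ^ 2 / R ^ n)) :=
    tendsto_nhdsWithin_of_tendsto_nhds hcont.tendsto
  have hle : ‖DtN Dt A' n‖ ≤ M * (R * ‖A'‖) ^ 2 / R ^ n := ge_of_tendsto hlim hev
  refine hle.trans (le_of_eq ?_)
  rw [hRA, hR, div_pow, div_div_eq_mul_div, div_pow]
  field_simp

include hL hG hU₀ hα hα3 hα4 h52 hb hsmall hc₃ in
/-- **THE TERMS ARE HOMOGENEOUS POLYNOMIALS**: `D̃⁽ⁿ⁾(s·A′) = sⁿ·D̃⁽ⁿ⁾(A′)` for every `s ∈ ℂ`, every `A′ ∈ 𝔸^S` and every `n` («D^{(n)} are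
homogeneous polynomials of n-th order») — the slice through `sA′` is `t ↦ D̃((st)A′)`, whose `n`-th derivative at `0` is `sⁿ` times that of
the slice through `A′` (both slices are analytic near `t = 0`). [cite: Balaban1985Variational, (56) p.286] -/
theorem DtN_smul {j : ℕ} (hj : j ≤ k) (hB₀ : 0 ≤ B₀) (hHop : ∀ X, ‖hop X‖ ≤ B₀ * ‖X‖)
    (hq : 9 * (C₂ * ((L : ℝ) ^ j) ^ 2) * B₀ * ε < 1) (hε : 3 * ε ≤ b) (hε0 : 0 < ε)
    (hDball : ∀ B : S → 𝔸, ‖B‖ < ε → Dt B ∈ closedBall (0 : T → 𝔸) (4 * (C₂ * ((L : ℝ) ^ j) ^ 2) * ε ^ 2))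
    (hDfix : ∀ B : S → 𝔸, ‖B‖ < ε → Cmap L U₀ S T j (B - hop (Dt B)) = Dt B) (A' : S → 𝔸) (s : ℂ) (n : ℕ) :
    DtN Dt (s • A') n = s ^ n • DtN Dt A' n := by
  -- the slice through `A′` is analytic near `0`: on the disc `|u| < ε/(‖A′‖ + 1)`
  have hA1 : 0 < ‖A'‖ + 1 := by positivity
  have hr0 : 0 < ε / (‖A'‖ + 1) := div_pos hε0 hA1
  have hψ : ∀ᶠ u in 𝓝 (0 : ℂ), AnalyticAt ℂ (fun t : ℂ => Dt (t • A')) u := by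
    filter_upwards [ball_mem_nhds (0 : ℂ) hr0] with u hu
    rw [mem_ball_zero_iff] at hu
    refine analyticAt_Dt_slice L hL hG k U₀ hU₀ hα hα3 hα4 h52 hb hsmall hc₃ S T hop hj hB₀ hHop hq hε hDball hDfix A' ?_
    have h1 : ‖u‖ * ‖A'‖ ≤ ‖u‖ * (‖A'‖ + 1) := mul_le_mul_of_nonneg_left (by linarith) (norm_nonneg u)
    have h2 : ‖u‖ * (‖A'‖ + 1) < ε := (lt_div_iff₀ hA1).1 hu
    linarith
  have h := (iteratedDeriv_comp_mul_eventually hψ s n).self_of_nhds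
  rw [mul_zero] at h
  have hfun : (fun t : ℂ => Dt (t • (s • A'))) = fun u : ℂ => (fun t : ℂ => Dt (t • A')) (s * u) := by
    funext u
    simp only [smul_smul, mul_comm u s]
  rw [DtN_def, DtN_def, hfun, h, smul_smul, smul_smul, mul_comm]

/-! ## §4 (56) as a convergent series -/

include hL hG hU₀ hα hα3 hα4 h52 hb hsmall hc₃ in
/-- **THE SLICE HAS A POWER SERIES ON EVERY DISC `|t| < r` WITH `r·‖A′‖ < ε`** (Mathlib `DiffContOnCl.hasFPowerSeriesOnBall`, Cauchy's integral
formula). [cite: Balaban1985Variational, (54) p.286, (56) p.286] -/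
theorem hasFPowerSeriesOnBall_Dt_slice {j : ℕ} (hj : j ≤ k) (hB₀ : 0 ≤ B₀) (hHop : ∀ X, ‖hop X‖ ≤ B₀ * ‖X‖)
    (hq : 9 * (C₂ * ((L : ℝ) ^ j) ^ 2) * B₀ * ε < 1) (hε : 3 * ε ≤ b)
    (hDball : ∀ B : S → 𝔸, ‖B‖ < ε → Dt B ∈ closedBall (0 : T → 𝔸) (4 * (C₂ * ((L : ℝ) ^ j) ^ 2) * ε ^ 2))
    (hDfix : ∀ B : S → 𝔸, ‖B‖ < ε → Cmap L U₀ S T j (B - hop (Dt B)) = Dt B) (A' : S → 𝔸) {r : ℝ} (hr0 : 0 < r)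
    (hr : r * ‖A'‖ < ε) :
    HasFPowerSeriesOnBall (fun u : ℂ => Dt (u • A'))
      (cauchyPowerSeries (fun u : ℂ => Dt (u • A')) 0 r) 0 (ENNReal.ofReal r) := by
  have hd := diffContOnCl_Dt_slice L hL hG k U₀ hU₀ hα hα3 hα4 h52 hb hsmall hc₃ S T hop hj hB₀ hHop hq hε hDball hDfix A' hr
  set R : ℝ≥0 := Real.toNNReal r with hRdef
  have hcoe : (R : ℝ) = r := Real.coe_toNNReal _ hr0.le
  have hRpos : 0 < R := by
    rw [← NNReal.coe_pos, hcoe]; exact hr0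
  have hd' : DiffContOnCl ℂ (fun u : ℂ => Dt (u • A')) (ball (0 : ℂ) (R : ℝ)) := by rwa [hcoe]
  have h := hd'.hasFPowerSeriesOnBall hRpos
  rw [hcoe] at h
  have he : (R : ENNReal) = ENNReal.ofReal r := by
    rw [← hcoe, ENNReal.ofReal_coe_nnreal]
  rwa [he] at h

include hL hG hU₀ hα hα3 hα4 h52 hb hsmall hc₃ in
/-- **(56) ALONG THE SLICE, AS A CONVERGENT SERIES**: `Σ_{n≥0} tⁿ·D̃⁽ⁿ⁾(A′) = D̃(tA′)` whenever `|t|·‖A′‖ < ε` (the Taylor series of the analytic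
slice, Mathlib `HasFPowerSeriesOnBall.hasSum_iteratedFDeriv`, on a disc of radius between `|t|` and `ε/‖A′‖`).
[cite: Balaban1985Variational, (56) p.286] -/
theorem hasSum_DtN_slice {j : ℕ} (hj : j ≤ k) (hB₀ : 0 ≤ B₀) (hHop : ∀ X, ‖hop X‖ ≤ B₀ * ‖X‖)
    (hq : 9 * (C₂ * ((L : ℝ) ^ j) ^ 2) * B₀ * ε < 1) (hε : 3 * ε ≤ b) (hε0 : 0 < ε)
    (hDball : ∀ B : S → 𝔸, ‖B‖ < ε → Dt B ∈ closedBall (0 : T → 𝔸) (4 * (C₂ * ((L : ℝ) ^ j) ^ 2) * ε ^ 2))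
    (hDfix : ∀ B : S → 𝔸, ‖B‖ < ε → Cmap L U₀ S T j (B - hop (Dt B)) = Dt B) (A' : S → 𝔸) {t : ℂ}
    (ht : ‖t‖ * ‖A'‖ < ε) :
    HasSum (fun n : ℕ => t ^ n • DtN Dt A' n) (Dt (t • A')) := by
  obtain ⟨r, htr, hr⟩ := exists_radius (norm_nonneg A') hε0 ht
  have hr0 : 0 < r := (norm_nonneg t).trans_lt htr
  have hps := hasFPowerSeriesOnBall_Dt_slice L hL hG k U₀ hU₀ hα hα3 hα4 h52 hb hsmall hc₃ S T hop hj hB₀ hHop hq hε hDball hDfix A'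
    hr0 hr
  have hy : t ∈ Metric.eball (0 : ℂ) (ENNReal.ofReal r) := by
    rw [Metric.mem_eball, edist_dist, dist_zero_right]
    exact (ENNReal.ofReal_lt_ofReal_iff hr0).2 htr
  have h := hps.hasSum_iteratedFDeriv hy
  rw [zero_add] at h
  have key : (fun n : ℕ => t ^ n • DtN Dt A' n) = fun n : ℕ =>
      ((Nat.factorial n : ℕ) : ℂ)⁻¹ • iteratedFDeriv ℂ n (fun u : ℂ => Dt (u • A')) 0 fun _ => t := by
    funext n
    rw [iteratedFDeriv_apply_eq_iteratedDeriv_mul_prod, Finset.prod_const, Finset.card_univ, Fintype.card_fin,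
      DtN_def, smul_smul, smul_smul, mul_comm]
  rw [key]
  exact h

include hL hG hU₀ hα hα3 hα4 h52 hb hsmall hc₃ in
/-- **(56) VERBATIM FOR THE CONCRETE `D̃`**: for every `A′` of the ball (51) `‖A′‖ < ε`, `Σ_{n≥0} D̃⁽ⁿ⁾(A′) = D̃(A′)` — the outer members of
(56) «C_j(LʲηA′ − LʲηHD(A′)) = … = Σ_{n=2}^∞ D^{(n)}(A′)», whose left member is `D(A′)` by (49) «C_j(LʲηA′ − LʲηHD(A′)) = D(A′) on Λ_j»
(the terms `n = 0, 1` vanish by `DtN_zero`/`DtN_one`; `n = 2` is `C⁽²⁾(A′)` by `DtN_two`). [cite: Balaban1985Variational, (56) p.286] -/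
theorem hasSum_DtN {j : ℕ} (hj : j ≤ k) (hB₀ : 0 ≤ B₀) (hHop : ∀ X, ‖hop X‖ ≤ B₀ * ‖X‖)
    (hq : 9 * (C₂ * ((L : ℝ) ^ j) ^ 2) * B₀ * ε < 1) (hε : 3 * ε ≤ b) (hε0 : 0 < ε)
    (hDball : ∀ B : S → 𝔸, ‖B‖ < ε → Dt B ∈ closedBall (0 : T → 𝔸) (4 * (C₂ * ((L : ℝ) ^ j) ^ 2) * ε ^ 2))
    (hDfix : ∀ B : S → 𝔸, ‖B‖ < ε → Cmap L U₀ S T j (B - hop (Dt B)) = Dt B) {A' : S → 𝔸} (hA : ‖A'‖ < ε) :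
    HasSum (fun n : ℕ => DtN Dt A' n) (Dt A') := by
  have h1 : ‖(1 : ℂ)‖ * ‖A'‖ < ε := by rwa [norm_one, one_mul]
  have h := hasSum_DtN_slice L hL hG k U₀ hU₀ hα hα3 hα4 h52 hb hsmall hc₃ S T hop hj hB₀ hHop hq hε hε0 hDball hDfix A' h1
  simp only [one_pow, one_smul] at h
  exact h

include hL hG hU₀ hα hα3 hα4 h52 hb hsmall hc₃ in
/-- (56) in `tsum` form: `D̃(A′) = Σ'_n D̃⁽ⁿ⁾(A′)` on the ball (51). [cite: Balaban1985Variational, (56) p.286] -/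
theorem Dt_eq_tsum {j : ℕ} (hj : j ≤ k) (hB₀ : 0 ≤ B₀) (hHop : ∀ X, ‖hop X‖ ≤ B₀ * ‖X‖)
    (hq : 9 * (C₂ * ((L : ℝ) ^ j) ^ 2) * B₀ * ε < 1) (hε : 3 * ε ≤ b) (hε0 : 0 < ε)
    (hDball : ∀ B : S → 𝔸, ‖B‖ < ε → Dt B ∈ closedBall (0 : T → 𝔸) (4 * (C₂ * ((L : ℝ) ^ j) ^ 2) * ε ^ 2))
    (hDfix : ∀ B : S → 𝔸, ‖B‖ < ε → Cmap L U₀ S T j (B - hop (Dt B)) = Dt B) {A' : S → 𝔸} (hA : ‖A'‖ < ε) :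
    Dt A' = ∑' n : ℕ, DtN Dt A' n :=
  (hasSum_DtN L hL hG k U₀ hU₀ hα hα3 hα4 h52 hb hsmall hc₃ S T hop hj hB₀ hHop hq hε hε0 hDball hDfix hA).tsum_eq.symm

include hL hG hU₀ hα hα3 hα4 h52 hb hsmall hc₃ in
/-- **THE REMAINDER OF (56) AFTER ANY ORDER**: for `‖A′‖ < ε` and every `N`,
`‖D̃(A′) − Σ_{n<N} D̃⁽ⁿ⁾(A′)‖ ≤ 4C₂(Lʲ)²ε²·(‖A′‖/ε)ᴺ·(1 − ‖A′‖/ε)⁻¹` (the tail, bounded termwise by `norm_DtN_le` and summed geometrically;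
`N = 3` is an `O(‖A′‖³)` remainder of «D = D^{(2)} + …» with the constant `4C₂ε₃⁻¹(1 − ‖A′‖/ε₃)⁻¹`). [cite: Balaban1985Variational, (56) p.286] -/
theorem norm_Dt_sub_partialSum_le {j : ℕ} (hj : j ≤ k) (hB₀ : 0 ≤ B₀) (hHop : ∀ X, ‖hop X‖ ≤ B₀ * ‖X‖)
    (hq : 9 * (C₂ * ((L : ℝ) ^ j) ^ 2) * B₀ * ε < 1) (hε : 3 * ε ≤ b) (hε0 : 0 < ε)
    (hDball : ∀ B : S → 𝔸, ‖B‖ < ε → Dt B ∈ closedBall (0 : T → 𝔸) (4 * (C₂ * ((L : ℝ) ^ j) ^ 2) * ε ^ 2))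
    (hDfix : ∀ B : S → 𝔸, ‖B‖ < ε → Cmap L U₀ S T j (B - hop (Dt B)) = Dt B) {A' : S → 𝔸} (hA : ‖A'‖ < ε) (N : ℕ) :
    ‖Dt A' - ∑ n ∈ Finset.range N, DtN Dt A' n‖ ≤
      4 * (C₂ * ((L : ℝ) ^ j) ^ 2) * ε ^ 2 * (‖A'‖ / ε) ^ N * (1 - ‖A'‖ / ε)⁻¹ := by
  set ρ : ℝ := ‖A'‖ / ε with hρ
  have hρ0 : 0 ≤ ρ := div_nonneg (norm_nonneg _) hε0.le
  have hρ1 : ρ < 1 := (div_lt_one hε0).2 hA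
  set K : ℝ := 4 * (C₂ * ((L : ℝ) ^ j) ^ 2) * ε ^ 2 with hK
  have hK0 : 0 ≤ K := by positivity
  have hf := (hasSum_nat_add_iff' N).2
    (hasSum_DtN L hL hG k U₀ hU₀ hα hα3 hα4 h52 hb hsmall hc₃ S T hop hj hB₀ hHop hq hε hε0 hDball hDfix hA)
  have hg : HasSum (fun n : ℕ => K * ρ ^ N * ρ ^ n) (K * ρ ^ N * (1 - ρ)⁻¹) :=
    (hasSum_geometric_of_lt_one hρ0 hρ1).mul_left (K * ρ ^ N)
  have hle : ∀ n : ℕ, ‖DtN Dt A' (n + N)‖ ≤ K * ρ ^ N * ρ ^ n := by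
    intro n
    have h := norm_DtN_le L hL hG k U₀ hU₀ hα hα3 hα4 h52 hb hsmall hc₃ S T hop hj hB₀ hHop hq hε hε0 hDball hDfix A' (n + N)
    refine h.trans (le_of_eq ?_)
    rw [hK, hρ, pow_add]
    ring
  have h := hf.norm_le_of_bounded hg hle
  refine h.trans (le_of_eq ?_)
  rw [hK, hρ]

/-! ## §5 «For example we have on Λ_j D^{(2)}(A′) = C_j^{(2)}(LʲηA′)» (after (56)) as an identity of Taylor terms -/

include hL hG hU₀ hα hα3 hα4 h52 hb hsmall hc₃ h145 h155 in
/-- **`D̃⁽²⁾(A′) = C⁽²⁾(A′, A′)` FOR EVERY `A′` OF THE BALL (51)** — «For example we have on Λ_j D^{(2)}(A′) = C_j^{(2)}(LʲηA′)» (the sentence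
after (56), p. 286) read as the equality of the
SECOND TAYLOR TERM of `D̃` with the quadratic form `C2map A′ A′` of [4] (136): along the ray `tA′`, `t ↓ 0`, both `t²D̃⁽²⁾(A′)` (§4: the terms of
orders `0`, `1` vanish and the tail is `O(t³)`) and `t²C2map A′ A′ = C2map(tA′)(tA′)` (`B11Eq44Concrete.eq56_order2_concrete`: `‖D̃(tA′) −
C2map(tA′)(tA′)‖ = O(t³)`) approximate `D̃(tA′)` to third order, so their difference is `O(t)·t²`. [cite: Balaban1985Variational, (56) p.286]
[cite: Balaban1985Averaging, (136) p.39] -/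
theorem DtN_two {j : ℕ} (hj : j ≤ k) (hB₀ : 0 ≤ B₀) (hHop : ∀ X, ‖hop X‖ ≤ B₀ * ‖X‖)
    (hq : 9 * (C₂ * ((L : ℝ) ^ j) ^ 2) * B₀ * ε < 1) (hε : 3 * ε ≤ b) (hε0 : 0 < ε)
    (hDball : ∀ B : S → 𝔸, ‖B‖ < ε → Dt B ∈ closedBall (0 : T → 𝔸) (4 * (C₂ * ((L : ℝ) ^ j) ^ 2) * ε ^ 2))
    (hDfix : ∀ B : S → 𝔸, ‖B‖ < ε → Cmap L U₀ S T j (B - hop (Dt B)) = Dt B) {A' : S → 𝔸} (hA : ‖A'‖ < ε) :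
    DtN Dt A' 2 = C2map L U₀ S T j A' A' := by
  -- the two cubic constants
  set K₁ : ℝ := 4 * (C₂ * ((L : ℝ) ^ j) ^ 2) * ε ^ 2 * 2 with hK₁
  set K₂ : ℝ := (8 * (2 * (C₂ * ((L : ℝ) ^ j) ^ 2 * b⁻¹)) +
      12 * (d * (C3Gen d L * ((L : ℝ) ^ j) ^ 2)) * B₀ * (C₂ * ((L : ℝ) ^ j) ^ 2)) * ‖A'‖ ^ 3 with hK₂
  have hC3 : 0 ≤ C3Gen d L := by unfold C3Gen C1ppGen; positivity
  have hK₁0 : 0 ≤ K₁ := by positivity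
  have hK₂0 : 0 ≤ K₂ := by
    have := hb.le
    positivity
  set E : T → 𝔸 := DtN Dt A' 2 - C2map L U₀ S T j A' A' with hE
  -- KEY ESTIMATE: for real `0 < t ≤ 1/2`, `t²‖E‖ ≤ (K₁ + K₂)t³`
  have key : ∀ t : ℝ, 0 < t → t ≤ 1 / 2 → t ^ 2 * ‖E‖ ≤ (K₁ + K₂) * t ^ 3 := by
    intro t ht0 ht1
    have htc : ‖(t : ℂ)‖ = t := by rw [Complex.norm_real, Real.norm_eq_abs, abs_of_pos ht0]
    -- the point `tA′` is in the ball, with `‖tA′‖/ε ≤ 1/2`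
    have htA : ‖(t : ℂ) • A'‖ = t * ‖A'‖ := by rw [norm_smul, htc]
    have htAε : ‖(t : ℂ) • A'‖ < ε := by
      rw [htA]
      calc t * ‖A'‖ ≤ 1 / 2 * ‖A'‖ := mul_le_mul_of_nonneg_right ht1 (norm_nonneg _)
        _ < ε := by linarith [norm_nonneg A']
    have hρ : ‖(t : ℂ) • A'‖ / ε ≤ t := by
      rw [htA, div_le_iff₀ hε0]
      exact mul_le_mul_of_nonneg_left hA.le ht0.le
    have hρ' : ‖(t : ℂ) • A'‖ / ε ≤ 1 / 2 := hρ.trans ht1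
    have hρ0 : 0 ≤ ‖(t : ℂ) • A'‖ / ε := div_nonneg (norm_nonneg _) hε0.le
    -- (i) the tail of (56) at `tA′` after order two: `‖D̃(tA′) − t²D̃⁽²⁾(A′)‖ ≤ K₁t³`
    have h1 : ‖Dt ((t : ℂ) • A') - (t : ℂ) ^ 2 • DtN Dt A' 2‖ ≤ K₁ * t ^ 3 := by
      have htail := norm_Dt_sub_partialSum_le L hL hG k U₀ hU₀ hα hα3 hα4 h52 hb hsmall hc₃ S T hop hj hB₀ hHop hq hε hε0 hDball
        hDfix htAε 3
      have hsum : ∑ n ∈ Finset.range 3, DtN Dt ((t : ℂ) • A') n = (t : ℂ) ^ 2 • DtN Dt A' 2 := by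
        rw [Finset.sum_range_succ, Finset.sum_range_succ, Finset.sum_range_succ, Finset.sum_range_zero,
          DtN_zero L hL hG k U₀ hU₀ hα hα3 hα4 h52 hb hsmall hc₃ S T hop hj hB₀ hHop hq hε hε0 hDball hDfix,
          DtN_one L hL hG k U₀ hU₀ hα hα3 hα4 h52 hb hsmall hc₃ S T hop hj hB₀ hHop hq hε hε0 hDball hDfix,
          DtN_smul L hL hG k U₀ hU₀ hα hα3 hα4 h52 hb hsmall hc₃ S T hop hj hB₀ hHop hq hε hε0 hDball hDfix A' (t : ℂ) 2]
        simp
      rw [hsum] at htail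
      refine htail.trans ?_
      have hgeo : (1 - ‖(t : ℂ) • A'‖ / ε)⁻¹ ≤ 2 := by
        rw [inv_le_comm₀ (by linarith) (by norm_num : (0 : ℝ) < 2)]
        linarith
      have hcube : (‖(t : ℂ) • A'‖ / ε) ^ 3 ≤ t ^ 3 := pow_le_pow_left₀ hρ0 hρ 3
      calc 4 * (C₂ * ((L : ℝ) ^ j) ^ 2) * ε ^ 2 * (‖(t : ℂ) • A'‖ / ε) ^ 3 * (1 - ‖(t : ℂ) • A'‖ / ε)⁻¹
          ≤ 4 * (C₂ * ((L : ℝ) ^ j) ^ 2) * ε ^ 2 * t ^ 3 * 2 := by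
            exact mul_le_mul (mul_le_mul_of_nonneg_left hcube (by positivity)) hgeo (inv_nonneg.2 (by linarith)) (by positivity)
        _ = K₁ * t ^ 3 := by rw [hK₁]; ring
    -- (ii) the order-two remainder of `B11Eq44Concrete` at `tA′`: `‖D̃(tA′) − t²C2map A′ A′‖ ≤ K₂t³`
    have h2 : ‖Dt ((t : ℂ) • A') - (t : ℂ) ^ 2 • C2map L U₀ S T j A' A'‖ ≤ K₂ * t ^ 3 := by
      have h56 := eq56_order2_concrete L hL hG k U₀ hU₀ hα hα3 hα4 h52 hb hsmall hc₃ h145 h155 S T hop hj hB₀ hHop htAε hq hε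
        (hDball _ htAε) (hDfix _ htAε)
      have hbil : C2map L U₀ S T j ((t : ℂ) • A') ((t : ℂ) • A') = (t : ℂ) ^ 2 • C2map L U₀ S T j A' A' := by
        rw [LinearMap.map_smul₂, LinearMap.map_smul, smul_smul, pow_two]
      rw [hbil] at h56
      refine h56.trans (le_of_eq ?_)
      rw [htA, hK₂]
      ring
    -- (iii) subtract
    have hdiff : (t : ℂ) ^ 2 • E =
        (Dt ((t : ℂ) • A') - (t : ℂ) ^ 2 • C2map L U₀ S T j A' A') - (Dt ((t : ℂ) • A') - (t : ℂ) ^ 2 • DtN Dt A' 2) := by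
      rw [hE, smul_sub]; abel
    have hnorm : ‖(t : ℂ) ^ 2 • E‖ = t ^ 2 * ‖E‖ := by rw [norm_smul, norm_pow, htc]
    calc t ^ 2 * ‖E‖ = ‖(t : ℂ) ^ 2 • E‖ := hnorm.symm
      _ ≤ ‖Dt ((t : ℂ) • A') - (t : ℂ) ^ 2 • C2map L U₀ S T j A' A'‖ + ‖Dt ((t : ℂ) • A') - (t : ℂ) ^ 2 • DtN Dt A' 2‖ := by
          rw [hdiff]; exact norm_sub_le _ _
      _ ≤ K₂ * t ^ 3 + K₁ * t ^ 3 := add_le_add h2 h1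
      _ = (K₁ + K₂) * t ^ 3 := by ring
  -- hence `‖E‖ ≤ (K₁ + K₂)t` for all small `t > 0`, so `E = 0`
  clear_value K₁ K₂
  have hE0 : ‖E‖ ≤ 0 := by
    refine le_of_forall_pos_le_add fun δ hδ => ?_
    rw [zero_add]
    have hKp : 0 < K₁ + K₂ + 1 := by linarith
    obtain ⟨t, ht0, ht1, ht2⟩ : ∃ t : ℝ, 0 < t ∧ t ≤ 1 / 2 ∧ t ≤ δ / (K₁ + K₂ + 1) :=
      ⟨min (1 / 2) (δ / (K₁ + K₂ + 1)), lt_min (by norm_num) (div_pos hδ hKp), min_le_left _ _, min_le_right _ _⟩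
    have hk := key t ht0 ht1
    have hE1 : ‖E‖ ≤ (K₁ + K₂) * t := by
      have h' : t ^ 2 * ‖E‖ ≤ t ^ 2 * ((K₁ + K₂) * t) := by
        rw [show t ^ 2 * ((K₁ + K₂) * t) = (K₁ + K₂) * t ^ 3 by ring]; exact hk
      exact le_of_mul_le_mul_left h' (by positivity)
    have hfrac : (K₁ + K₂) / (K₁ + K₂ + 1) ≤ 1 := (div_le_one hKp).2 (by linarith)
    calc ‖E‖ ≤ (K₁ + K₂) * t := hE1
      _ ≤ (K₁ + K₂) * (δ / (K₁ + K₂ + 1)) := mul_le_mul_of_nonneg_left ht2 (by linarith)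
      _ = δ * ((K₁ + K₂) / (K₁ + K₂ + 1)) := by ring
      _ ≤ δ * 1 := mul_le_mul_of_nonneg_left hfrac hδ.le
      _ = δ := mul_one δ
  have hE' : E = 0 := norm_le_zero_iff.mp hE0
  rw [hE] at hE'
  exact sub_eq_zero.mp hE'

end Regime

end Literature.MathematicalPhysics.QuantumFieldTheory.Balaban1983to89.B11Eq56SeriesConcrete

end
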